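import Summits.Parity.BatemanHorn.Theorems.SelbergDelangeRigidityLSDRealSegmentCheapRowsAux
import HarnessLib

/-!
# Route `SelbergDelangeRigidity`, crux `LSDRealSegment` (stmt-Parity-9770), line
# `product-anatomy-subcritical`: the PROVABLE members of `stub_cheapRows`, and the diagnosis of the rest

`stub_cheapRows : ∀ k f, IsBatemanHornSystem f → Σ deg fᵢ ≤ 2 → CheapRows k f` has four members
(`∅`; one linear form; one irreducible quadratic; two non-associated linear forms).  Here: `CheapRows k f` for
EVERY family of total degree `≤ 1` (`cheapRows_of_sum_natDegree_le_one`, registered helper) — so the empty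
family (`cheapRows_fin_zero`) and the single linear member (`cheapRows_linear`) — with no Bateman–Horn
hypothesis used: for `k ≥ 1` the per-factor totals give `Σⱼ βⱼ ≤ Σᵢ (deg fᵢ − η₀) ≤ 1 − η₀` and the twist level
is `η' ≤ η₀/2`, so every admissible row has modulus `e ∏ pⱼ ≤ x^{1 − η₀/2}`: SUB-LEVEL, and `cheapRows_subLevel`
(complete periods, `…CheapRowsAux`) applies; for `k = 0` only `s = 0` is possible and the row
`#{1 ≤ n ≤ x : e ∣ 1}` equals its main term `x · [e = 1]` on the nose.

## Diagnosis of the two remaining members (write `θ := η' + Σⱼ βⱼ`, the exponent of the modulus `e ∏ pⱼ`)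

* `θ < 1` (sub-level): PROVED for every family (`cheapRows_subLevel`).  Besides the two members above this
  covers, for the quadratic member, every row with `s ≤ 1` (`θ ≤ 1 − η₀/2`) and every pure-twist row
  (`s = 0`) with `η' < 1` (`cheapRows_pureTwist`); for the linear pair, every row whose boxes sit on one factor.
* The corner `η₀ = 2, s = 0, η' = 1` of the quadratic member (admissible: with no boxes the only constraint on
  `η₀` is `0 ≤ deg − η₀`) is FALSE — twists `e` as long as the interval; see the companion
  `…CheapRowsFalse` (`stub_cheapRows_false`).  So `stub_cheapRows` is false AS TYPED; the intended statement
  needs `η₀ ≤ 1` (or `η' < 1`, or `2η' < η₀` strict) in `CheapRows`.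
* `θ ≥ 1`, quadratic member `g` (after that repair): rows `s ≥ 2`, `σ ≡ 0`; the per-factor and cheap-shape
  constraints allow `θ` up to `2 − η₀/2`.  Minimal open row (`e = 1`, level just above `1`): for `0 < δ < 1/6`,
  `η₀ ∈ [2δ, 1/2 − δ]`, `s = 2`, `σ = ![0, 0]`, `α = ![1/2, 1/2]`, `β = ![1/2 + δ, 1/2 + δ]`:
  `Σ_{p₁ ≠ p₂ prime ∈ (x^{1/2}, x^{1/2+δ}]} #{1 ≤ n ≤ x : p₁ p₂ ∣ g(n)} = (1 + o(1)) · x Σ ρ_g(p₁p₂)/(p₁p₂)`,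
  i.e. SIGNED equidistribution of the roots of `g` to balanced two-prime moduli `p₁p₂ ∈ (x, x^{1+2δ}]` on the
  initial segment `[1, x]` of one period.  In the tree: `dukeFriedlanderIwaniecToth_quadraticRoots_primeModuli`
  (prime moduli, level `< 1`) does not reach it; `Iwaniec1978.proposition1_corollary_holds` (PROVED, `X² + 1`
  only) has level `x^{1 + 1/15 − ε}` but LOPSIDED moduli `m n`, `n ≤ x^{1/15 − ε}` squarefree-supported — it
  yields only the rows of `X² + 1` with one box below `x^{1/15}` and squarefree twists; the general-`g` analogue
  is the named fact `lemkeOliver2012_quadraticRoots_level`.  Balanced level `1 + 2δ` for products of two primes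
  is open (de la Bretèche–Drappeau 2020 reach level `x^{1+δ₀}`, some small absolute `δ₀ > 0`, for prime and
  linear-sieve-factorable moduli — not products of two primes of free balanced size with relative error `o(1)`).
* `θ ≥ 1`, linear pair `(X + b₁, X + b₂)` (`b₁ ≠ b₂`; `aᵢ X + bᵢ` alike): rows `s = 2`, `σ = id`; cheap shape caps
  `βⱼ ≤ (1 + η₀)/2`, per-factor `βⱼ ≤ 1 − η₀`, so `1 ≤ θ ≤ 3/2`.  Minimal open row: same boxes as above,
  `Σ_{p₁ ≠ p₂ ∈ (x^{1/2}, x^{1/2+δ}]} (#{1 ≤ n ≤ x : n ≡ −b₁ (p₁), n ≡ −b₂ (p₂)} − x/(p₁p₂)) = o(x)`.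
  By CRT and Bézout reciprocity the class is `c/(p₁p₂) ≡ (b₂ − b₁) p̄₂/p₁ − b₂/(p₁p₂) (mod 1)`, so after
  `#{n ≤ x : n ≡ c (q)} = x/q − ψ((x − c)/q) + ψ(−c/q)` and Vaaler's trigonometric approximation of `ψ`
  (`H = x^{θ − 1 + ε}`) the error is `Σ_{0<|h|≤H} |h|⁻¹ |Σ_{p₁, p₂} e(h(b₂ − b₁) p̄₂/p₁ + h(x + b₂)/(p₁p₂))| + o(x)`
  — exactly the bilinear Kloosterman-fraction sum of the PROVED tree fact
  `Literature.NumberTheory.LFunctions.DukeFriedlanderIwaniec1997_bilinearKloostermanFractions(_holds)` with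
  `k = h(b₂ − b₁) ≠ 0`, `X = h(x + b₂)` (`|X|/(MN) ≤ x^{ε}`), `α, β` = prime indicators on dyadic pieces:
  bound `(MN)^{1/2} (|k| + MN)^{3/8} (M + N)^{11/48 + ε} = x^{95θ/96 + o(1)}` at `M = N = x^{θ/2}`, which is
  `o(x)` iff `θ < 96/95`.  So DFI 1997 gives the balanced linear-pair rows with `1 ≤ θ < 96/95` (a twist
  `e ≤ x^{η'}` costs a splitting into `≤ ρ_F(e) e²` residue-class pieces, a factor `x^{O(η')}`), through a long
  but routine derivation (dyadic decomposition, Vaaler, CRT bookkeeping; several hundred lines at least) not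
  carried out here; the rows with `96/95 ≤ θ ≤ 3/2` are open (the endpoint is DFI-optimal strength, cf. the open crux
  `Summit.Parity.BatemanHorn.Theses.GaussianFractions.RootFractionsBound`).
-/

open Filter Finset Polynomial
open scoped BigOperators Topology Classical

namespace Summit.Parity.BatemanHorn.Cruxes.LSDRealSegment.ProductAnatomySubcritical

open Literature.NumberTheory.Sieve
open ArithmeticFunction (cardFactors)
noncomputable section

/-- For the EMPTY family every row equals its main term exactly: the condition is `e ∣ 1`, independent of `n`
(only `s = 0` occurs, `Fin s → Fin 0` being empty otherwise). [folklore] -/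
theorem cheapRow_eq_cheapMain_fin_zero (f : Fin 0 → ℤ[X]) (σ : Fin 0 → Fin 0) (α β : Fin 0 → ℝ)
    (e x : ℕ) : (cheapRow f σ α β e x : ℝ) = cheapMain f σ α β e x := by
  rw [cheapRow_fin_zero, cheapMain_fin_zero]
  unfold polyRootCountMod
  simp only [Finset.univ_eq_empty, Finset.prod_empty]
  by_cases he : (e : ℤ) ∣ 1
  · have he1 : e = 1 := by
      rw [← Nat.cast_one, Int.natCast_dvd_natCast, Nat.dvd_one] at he
      exact he
    subst he1
    simp
  · simp [Finset.filter_false_of_mem fun n _ => he]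

/-- **cheapRows_of_sum_natDegree_le_one** (registered helper of `stub_cheapRows`, line
`product-anatomy-subcritical`): `CheapRows k f` holds for EVERY family of total degree `≤ 1` — all its admissible
rows are sub-level (`k ≥ 1`: `Σⱼ βⱼ + η' ≤ 1 − η₀/2`; `k = 0`: exact equality). No Bateman–Horn hypothesis is
needed. [folklore] -/
theorem cheapRows_of_sum_natDegree_le_one :
    ∀ (k : ℕ) (f : Fin k → ℤ[X]), (∑ i, (f i).natDegree) ≤ 1 → CheapRows k f := by
  intro k f hdeg η₀ hη₀ s σ α β hbox hfac _hshape η' _hη' h2 ε hε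
  rcases Nat.eq_zero_or_pos k with rfl | hk
  · rcases Nat.eq_zero_or_pos s with rfl | hs
    · refine Filter.Eventually.of_forall fun x e _ _ _ => ?_
      have hσ : σ = Fin.elim0 := funext fun j => j.elim0
      subst hσ
      rw [cheapRow_eq_cheapMain_fin_zero, sub_self, abs_zero]
      exact mul_nonneg hε.le (cheapMain_nonneg f _ α β e x)
    · exact (σ ⟨0, hs⟩).elim0
  · have hsub : η' + ∑ j, β j < 1 := by
      have h1 : ∑ j, β j = ∑ i, ∑ j ∈ univ.filter (fun j => σ j = i), β j :=
        (Finset.sum_fiberwise univ σ β).symm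
      have h3 : ∑ i : Fin k, ∑ j ∈ univ.filter (fun j => σ j = i), β j ≤
          ∑ i : Fin k, (((f i).natDegree : ℝ) - η₀) := Finset.sum_le_sum fun i _ => hfac i
      rw [Finset.sum_sub_distrib, Finset.sum_const, Finset.card_univ, Fintype.card_fin, nsmul_eq_mul] at h3
      have h4 : ∑ i : Fin k, ((f i).natDegree : ℝ) ≤ 1 := by exact_mod_cast hdeg
      have hk1 : (1 : ℝ) ≤ k := by exact_mod_cast hk
      have h5 : η₀ ≤ (k : ℝ) * η₀ := le_mul_of_one_le_left hη₀.le hk1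
      linarith
    filter_upwards [cheapRows_subLevel k f s σ α β η' hsub ε hε] with x hx e he hex _
    exact hx e he hex

/-- The empty family: `CheapRows 0 f`. [folklore] -/
theorem cheapRows_fin_zero : ∀ (f : Fin 0 → ℤ[X]), IsBatemanHornSystem f → CheapRows 0 f :=
  fun f _ => cheapRows_of_sum_natDegree_le_one 0 f (by simp)

/-- The single linear member: `CheapRows 1 f` for `deg f₀ = 1` (all rows have modulus `≤ x^{1 − η₀/2}`). [folklore] -/
theorem cheapRows_linear :
    ∀ (f : Fin 1 → ℤ[X]), IsBatemanHornSystem f → (f 0).natDegree = 1 → CheapRows 1 f :=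
  fun f _ h => cheapRows_of_sum_natDegree_le_one 1 f (by simp [h])

end

end Summit.Parity.BatemanHorn.Cruxes.LSDRealSegment.ProductAnatomySubcritical
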